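import Mathlib
import Literature.NumberTheory.Transcendental.KZCalculus
import Summits.KontsevichZagierPeriods.KontsevichZagierPeriods.Theses.UnfoldedStokes

/-!
# Sketch — crux stmt-KontsevichZagierPeriods-3523 (UnfoldedStokes.LegendreAllModuli), crux-ideate r1 ideator 1

First-lemma signatures for the two idea cards
* `epsilon-addition-corner-residue` (card A): `SingleCellForm`, `LRegionStokes`, `CornerBlowup`,
  `residue_limit`, `ArctanTailPos`, composition shape `cardA_line_shape`;
* `nodal-cusp-band-transfer` (card B): `SwapSymmetrisation`, `NodalBandMove`, `CertificateKillsBand`,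
  `NodalFibreValue`, composition shape `cardB_line_shape`.
Nothing is proved here; every `def … : Prop` must elaborate.
-/

noncomputable section

open Set Literature.NumberTheory.Transcendental

namespace Summit.KontsevichZagierPeriods.KontsevichZagierPeriods.Cruxes.LegendreAllModuli.Sketch

/-! ## Common data -/

/-- The crux's left integrand `f_k` on `(0,1)²`, verbatim from the route decl. -/
def cruxIntegrand (k : ℝ) (x : Fin 2 → ℝ) : ℝ :=
  Real.sqrt (1 - k ^ 2 * x 0 ^ 2) / Real.sqrt (1 - x 0 ^ 2) / Real.sqrt ((1 - x 1 ^ 2) * (1 - (1 - k ^ 2) * x 1 ^ 2)) +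
    Real.sqrt (1 - (1 - k ^ 2) * x 0 ^ 2) / Real.sqrt (1 - x 0 ^ 2) / Real.sqrt ((1 - x 1 ^ 2) * (1 - k ^ 2 * x 1 ^ 2)) -
    1 / Real.sqrt ((1 - x 0 ^ 2) * (1 - k ^ 2 * x 0 ^ 2)) / Real.sqrt ((1 - x 1 ^ 2) * (1 - (1 - k ^ 2) * x 1 ^ 2))

/-- The open unit square, in the crux's typing. -/
def unitSq : Set (Fin 2 → ℝ) := {x | ∀ i, x i ∈ Ioo (0 : ℝ) 1}

/-- The arctangent representation on the positive half-line, `[(0,∞), 1/(1+σ²)]` (value π/2). -/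
def IsArctanPos (q : KZ.IntegralRep 1) : Prop :=
  q.domain = {t | 0 < t 0} ∧ EqOn q.integrand (fun t => 1 / (1 + t 0 ^ 2)) q.domain

/-- The crux's right representation `[ℝ, 1/(2(1+x²))]`. -/
def IsArctanR (r' : KZ.IntegralRep 1) : Prop :=
  r'.domain = Set.univ ∧ EqOn r'.integrand (fun x => 1 / (2 * (1 + x 0 ^ 2))) r'.domain

/-! ## Card A — epsilon-addition primitive + corner residue -/

/-- `y₁ = √((1−x²)(1−k²x²))` (real on `(0,1)`). -/
def wIn (k x : ℝ) : ℝ := Real.sqrt ((1 - x ^ 2) * (1 - k ^ 2 * x ^ 2))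

/-- `w₂ = √((x²−1)(1−k²x²))` (real on `(1,1/k)`). -/
def wOut (k x : ℝ) : ℝ := Real.sqrt ((x ^ 2 - 1) * (1 - k ^ 2 * x ^ 2))

/-- The single-cell Legendre integrand `F = k²(x₂²−x₁²)/(y₁ w₂)` on `C = (0,1)×(1,1/k)`. -/
def cellIntegrand (k : ℝ) (x : Fin 2 → ℝ) : ℝ :=
  k ^ 2 * (x 1 ^ 2 - x 0 ^ 2) / (wIn k (x 0) * wOut k (x 1))

/-- The cell `C = (0,1) × (1,1/k)`. -/
def cell (k : ℝ) : Set (Fin 2 → ℝ) := {x | 0 < x 0 ∧ x 0 < 1 ∧ 1 < x 1 ∧ x 1 < 1 / k}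

/-- Certificate, `dx₁`-coefficient: `A = −k²x₁²x₂w₂/((1−k²x₁²x₂²)y₁)`. -/
def certA (k : ℝ) (x : Fin 2 → ℝ) : ℝ :=
  -(k ^ 2 * x 0 ^ 2 * x 1 * wOut k (x 1)) / ((1 - k ^ 2 * x 0 ^ 2 * x 1 ^ 2) * wIn k (x 0))

/-- Certificate, `dx₂`-coefficient: `B = k²x₁x₂²y₁/((1−k²x₁²x₂²)w₂)`; `∂₁B − ∂₂A = F` (kit j015083). -/
def certB (k : ℝ) (x : Fin 2 → ℝ) : ℝ :=
  k ^ 2 * x 0 * x 1 ^ 2 * wIn k (x 0) / ((1 - k ^ 2 * x 0 ^ 2 * x 1 ^ 2) * wOut k (x 1))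

/-- The residue density on the exceptional divisor: `ρ(τ) = lim_{s→0⁺} s·B(1−s, 1/k−sτ)`. -/
def residueDensity (k τ : ℝ) : ℝ := Real.sqrt (k / τ) / (2 * (1 + k * τ))

/-- STEP 0 (conversion; provable now, ≈ 8 moves): the crux rep on `(0,1)²` is KZ-equivalent to the
single-cell rep `[C, F]` (two substitutions `y = √(x²−1)/(k′x)`, one swap, one Newton–Leibniz with
primitive `w₂/x₂ · 1/y₁`, integrand additivity). -/
def SingleCellForm : Prop :=
  ∀ k : ℝ, IsAlgebraic ℚ k → 0 < k → k < 1 →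
    ∀ (r r'' : KZ.IntegralRep 2), r.domain = unitSq → EqOn r.integrand (cruxIntegrand k) r.domain →
      r''.domain = cell k → EqOn r''.integrand (cellIntegrand k) r''.domain → KZ.Equivalent r r''

/-- STEP 1 (Stokes on the L-region; provable now, 4 Newton–Leibniz moves + additivity): with the
corner box `(1−δ,1)×(1/k−δ′,1/k)` removed, `[R₁,F] + [R₂,F]` reduces to the two inner cut-edge
representations `[(1/k−δ′,1/k), B(1−δ,·)] − [(1−δ,1), A(·,1/k−δ′)]` (all outer edge values of
`A`, `B` vanish identically). -/
def LRegionStokes : Prop :=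
  ∀ k : ℝ, IsAlgebraic ℚ k → 0 < k → k < 1 → ∀ δ δ' : ℚ, 0 < δ → δ < 1 → 0 < δ' → (δ' : ℝ) < 1 / k - 1 →
    ∀ (R₁ R₂ : KZ.IntegralRep 2) (e₁ e₂ : KZ.IntegralRep 1),
      R₁.domain = {x | 0 < x 0 ∧ x 0 < 1 - (δ : ℝ) ∧ 1 < x 1 ∧ x 1 < 1 / k} →
      EqOn R₁.integrand (cellIntegrand k) R₁.domain →
      R₂.domain = {x | 1 - (δ : ℝ) < x 0 ∧ x 0 < 1 ∧ 1 < x 1 ∧ x 1 < 1 / k - (δ' : ℝ)} →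
      EqOn R₂.integrand (cellIntegrand k) R₂.domain →
      e₁.domain = {t | 1 / k - (δ' : ℝ) < t 0 ∧ t 0 < 1 / k} →
      EqOn e₁.integrand (fun t => certB k ![1 - (δ : ℝ), t 0]) e₁.domain →
      e₂.domain = {t | 1 - (δ : ℝ) < t 0 ∧ t 0 < 1} →
      EqOn e₂.integrand (fun t => certA k ![t 0, 1 / k - (δ' : ℝ)]) e₂.domain →
      KZ.of R₁ + KZ.of R₂ - KZ.of e₁ + KZ.of e₂ ∈ KZ.relations

/-- STEP 2 (THE LEVER — corner blow-up; the card's first lemma): the corner box plus the two inner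
cut-edge representations is KZ-equivalent to the arctangent representation `[(0,∞), 1/(1+σ²)]`:
two polynomial blow-up charts `(s,τ) ↦ (1−s, 1/k−sτ)`, `(μ,t) ↦ (1−μt, 1/k−t)` (Jacobians `s`, `t`),
Newton–Leibniz along `s`, `τ` (resp. `t`, `μ`) with the pulled-back primitives `−s·B`, `−(A+τB)`
(continuous up to the exceptional divisor), whose face `s = 0` contributes `[(0,c), ρ]`,
`ρ(τ) = √(k/τ)/(2(1+kτ))`, and `τ = σ²/k`. -/
def CornerBlowup : Prop :=
  ∀ k : ℝ, IsAlgebraic ℚ k → 0 < k → k < 1 → ∀ δ δ' : ℚ, 0 < δ → δ < 1 → 0 < δ' → (δ' : ℝ) < 1 / k - 1 →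
    ∀ (Rb : KZ.IntegralRep 2) (e₁ e₂ q : KZ.IntegralRep 1),
      Rb.domain = {x | 1 - (δ : ℝ) < x 0 ∧ x 0 < 1 ∧ 1 / k - (δ' : ℝ) < x 1 ∧ x 1 < 1 / k} →
      EqOn Rb.integrand (cellIntegrand k) Rb.domain →
      e₁.domain = {t | 1 / k - (δ' : ℝ) < t 0 ∧ t 0 < 1 / k} →
      EqOn e₁.integrand (fun t => certB k ![1 - (δ : ℝ), t 0]) e₁.domain →
      e₂.domain = {t | 1 - (δ : ℝ) < t 0 ∧ t 0 < 1} →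
      EqOn e₂.integrand (fun t => certA k ![t 0, 1 / k - (δ' : ℝ)]) e₂.domain →
      IsArctanPos q →
      KZ.of Rb + KZ.of e₁ - KZ.of e₂ - KZ.of q ∈ KZ.relations

/-- The residue computation behind STEP 2 (elementary; exact by kit j015083):
`s · B(1−s, 1/k − sτ) → ρ(τ)` as `s → 0⁺`, for every `τ > 0`. -/
def ResidueLimit : Prop :=
  ∀ k τ : ℝ, 0 < k → k < 1 → 0 < τ →
    Filter.Tendsto (fun s : ℝ => s * certB k ![1 - s, 1 / k - s * τ]) (nhdsWithin 0 (Ioi 0))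
      (nhds (residueDensity k τ))

/-- STEP 3 (tail; shared with the 0280 lines' `ArctanTail`): `[(0,∞), 1/(1+σ²)] ~ [ℝ, 1/(2(1+x²))]`. -/
def ArctanTailPos : Prop :=
  ∀ (q r' : KZ.IntegralRep 1), IsArctanPos q → IsArctanR r' → KZ.Equivalent q r'

/-- Composition shape of card A (the three steps and domain additivity `C = R₁ ∪ R₂ ∪ box` give the crux). -/
def cardA_line_shape : Prop :=
  SingleCellForm → LRegionStokes → CornerBlowup → ArctanTailPos →
    Summit.KontsevichZagierPeriods.KontsevichZagierPeriods.Theses.UnfoldedStokes.LegendreAllModuli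

/-! ## Card B — nodal cusp band (transfer of the 0280 / GaussManinCertificates lever) -/

/-- `κₘ(t) = 1/√((1−t²)(1−mt²))`. -/
def kap (m t : ℝ) : ℝ := 1 / Real.sqrt ((1 - t ^ 2) * (1 - m * t ^ 2))

/-- `eₘ(t) = √(1−mt²)/√(1−t²)`. -/
def eps (m t : ℝ) : ℝ := Real.sqrt (1 - m * t ^ 2) / Real.sqrt (1 - t ^ 2)

/-- The symmetrised one-representation Legendre family `F_m(x,y) = κₘ(x)e_{1−m}(y) + eₘ(x)κ_{1−m}(y) − κₘ(x)κ_{1−m}(y)`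
(route GaussManinCertificates' `LegendreSector` integrand; `F_0 = 1/√(1−x²)` pointwise). -/
def famF (m : ℝ) (x : Fin 2 → ℝ) : ℝ :=
  kap m (x 0) * eps (1 - m) (x 1) + eps m (x 0) * kap (1 - m) (x 1) - kap m (x 0) * kap (1 - m) (x 1)

/-- Gauss–Manin certificate `G₁ = ½x(1−x²)y²κₘ(x)κ_{1−m}(y)` (zero at `x = 0, 1`). -/
def certG₁ (m : ℝ) (x : Fin 2 → ℝ) : ℝ := x 0 * (1 - x 0 ^ 2) * x 1 ^ 2 * kap m (x 0) * kap (1 - m) (x 1) / 2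

/-- Gauss–Manin certificate `G₂ = −½x²y(1−y²)κₘ(x)κ_{1−m}(y)` (zero at `y = 0, 1`). -/
def certG₂ (m : ℝ) (x : Fin 2 → ℝ) : ℝ := -(x 0 ^ 2 * x 1 * (1 - x 1 ^ 2) * kap m (x 0) * kap (1 - m) (x 1)) / 2

/-- B0 (provable now, one swap + additivity): `[□, f_k] ~ [□, F_{k²}]` (they differ by `h − h∘swap`,
`h = e_{k′}(x)κ_k(y)`). -/
def SwapSymmetrisation : Prop :=
  ∀ k : ℝ, IsAlgebraic ℚ k → 0 < k → k < 1 →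
    ∀ (r rF : KZ.IntegralRep 2), r.domain = unitSq → EqOn r.integrand (cruxIntegrand k) r.domain →
      rF.domain = unitSq → EqOn rF.integrand (famF (k ^ 2)) rF.domain → KZ.Equivalent r rF

/-- B1 (THE TRANSFERRED LEVER): ONE Newton–Leibniz move in the modulus over the CLOSED band
`(0,1)² × [0, k²]` with primitive `F` itself reaches the nodal fibre:
`[band, ∂ₘF] − [□, F_{k²}] + [□, 1/√(1−x²)] ∈ relations`. -/
def NodalBandMove : Prop :=
  ∀ k : ℝ, IsAlgebraic ℚ k → 0 < k → k < 1 →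
    ∀ (Rb : KZ.IntegralRep 3) (rF r₀ : KZ.IntegralRep 2),
      Rb.domain = {z | z 0 ∈ Ioo (0 : ℝ) 1 ∧ z 1 ∈ Ioo (0 : ℝ) 1 ∧ z 2 ∈ Icc (0 : ℝ) (k ^ 2)} →
      EqOn Rb.integrand (fun z => deriv (fun m => famF m ![z 0, z 1]) (z 2)) Rb.domain →
      rF.domain = unitSq → EqOn rF.integrand (famF (k ^ 2)) rF.domain →
      r₀.domain = unitSq → EqOn r₀.integrand (fun x => 1 / Real.sqrt (1 - x 0 ^ 2)) r₀.domain →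
      KZ.of Rb - KZ.of rF + KZ.of r₀ ∈ KZ.relations

/-- B2: the band dies by the certificate `∂ₘF = ∂ₓG₁ + ∂_yG₂` (two more Newton–Leibniz moves with
algebraic primitives vanishing on the faces; `m > 0` on the open band). -/
def CertificateKillsBand : Prop :=
  ∀ k : ℝ, IsAlgebraic ℚ k → 0 < k → k < 1 →
    ∀ (Rb : KZ.IntegralRep 3),
      Rb.domain = {z | z 0 ∈ Ioo (0 : ℝ) 1 ∧ z 1 ∈ Ioo (0 : ℝ) 1 ∧ z 2 ∈ Icc (0 : ℝ) (k ^ 2)} →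
      EqOn Rb.integrand (fun z => deriv (fun m => famF m ![z 0, z 1]) (z 2)) Rb.domain →
      KZ.of Rb ∈ KZ.relations

/-- B3 (provable now): `[□, 1/√(1−x²)] ~ [ℝ, 1/(2(1+x²))]` (integrate out `y`, `x = 2t/(1+t²)`, tail). -/
def NodalFibreValue : Prop :=
  ∀ (r₀ : KZ.IntegralRep 2) (r' : KZ.IntegralRep 1), r₀.domain = unitSq →
    EqOn r₀.integrand (fun x => 1 / Real.sqrt (1 - x 0 ^ 2)) r₀.domain → IsArctanR r' → KZ.Equivalent r₀ r'

/-- Composition shape of card B. -/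
def cardB_line_shape : Prop :=
  SwapSymmetrisation → NodalBandMove → CertificateKillsBand → NodalFibreValue →
    Summit.KontsevichZagierPeriods.KontsevichZagierPeriods.Theses.UnfoldedStokes.LegendreAllModuli

end Summit.KontsevichZagierPeriods.KontsevichZagierPeriods.Cruxes.LegendreAllModuli.Sketch
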